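import Mathlib
import HarnessLib
import Literature.MathematicalPhysics.QuantumFieldTheory.OSLorentzInvariance

/-!
# A determinant-one tilt of a spatial axis of `ℝ⁴` into Euclidean time

Pure Euclidean geometry for the line `Sketch` of the crux `ContinuumLegGivenGap`
(stub `stub_smallRotation`): for a spatial index `i : Fin 3` and reals `σ ≠ 0`, `ρ > 0`, `g > 0`
there is a linear isometry `R` of `ℝ⁴` of determinant one and reals `c ∈ (0, 1]`, `s` of the sign of
`σ`, with `(R x)⁰ = c x⁰ + s x^{i+1}`, `(R⁻¹ x)⁰ = c x⁰ - s x^{i+1}`, `(1 - c) ρ ≤ g` and `|s| ρ ≤ g`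
(so that points with `|x⁰|, |x^{i+1}| ≤ ρ` move in time by at most `2g` under `R^{±1}`).

The witness is the tree's rotation `planeRot (d := 3) i φ` of the `(x⁰, x^{i+1})`-plane
(`Literature.MathematicalPhysics.QuantumFieldTheory.OSLorentzInvariance`) by the angle
`φ = ±θ` of the sign of `σ`, `θ = min 1 (g/ρ)`, with `c = cos φ`, `s = sin φ`:
`1 - cos φ ≤ φ²/2 ≤ |φ|` (as `|φ| ≤ 1`) and `|sin φ| ≤ |φ|` (Mathlib `Real.one_sub_sq_div_two_le_cos`,
`Real.abs_sin_le_abs`), `cos φ > 0` as `|φ| ≤ 1 < π/2`, and `σ sin φ > 0` as `0 < θ < π`.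
The determinant is one because `planeRot i φ` is the square of `planeRot i (φ/2)` (group law
`planeRot3_add`) and a linear isometry of `ℝ⁴` has determinant `±1` (its matrix in the standard
orthonormal basis is orthogonal, Mathlib `OrthonormalBasis.det_to_matrix_orthonormalBasis_real`).

References: folklore (Givens rotations). No definitions, no notation.
-/

noncomputable section

namespace Summit.QuantumFields.YangMills.Theorems.ContinuumLegGivenGap

open Literature.MathematicalPhysics.QuantumFieldTheory

/-! ### The one-parameter groups of `(x⁰, x^{i+1})`-plane rotations of `ℝ⁴` -/

/-- **Group law** `planeRot i (s + t) = planeRot i t ∘ planeRot i s` (addition formulas). [folklore] -/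
theorem planeRot3_add (i : Fin 3) (s t : ℝ) :
    planeRot (d := 3) i (s + t) = (planeRot (d := 3) i s).trans (planeRot (d := 3) i t) := by
  ext x j
  fin_cases i <;> fin_cases j <;> simp [Real.cos_add, Real.sin_add] <;> ring

/-- `(planeRot i t)⁻¹ = planeRot i (-t)` (pointwise). [folklore] -/
theorem planeRot3_symm_apply (i : Fin 3) (t : ℝ) (y : EuclideanSpace ℝ (Fin 4)) :
    (planeRot (d := 3) i t).symm y = planeRot (d := 3) i (-t) y := by
  apply (planeRot (d := 3) i t).injective
  rw [LinearIsometryEquiv.apply_symm_apply]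
  have h := planeRotLin_neg_apply_planeRotLin (d := 3) i (-t) y
  rw [neg_neg] at h
  exact h.symm

/-- **The determinant of a linear isometry of `ℝ⁴` is `±1`** (its matrix in the standard orthonormal
basis is orthogonal). [folklore] -/
theorem det_isometry4_eq_one_or_eq_neg_one (R : EuclideanSpace ℝ (Fin 4) ≃ₗᵢ[ℝ] EuclideanSpace ℝ (Fin 4)) :
    LinearMap.det (R.toLinearEquiv : EuclideanSpace ℝ (Fin 4) →ₗ[ℝ] EuclideanSpace ℝ (Fin 4)) = 1 ∨
      LinearMap.det (R.toLinearEquiv : EuclideanSpace ℝ (Fin 4) →ₗ[ℝ] EuclideanSpace ℝ (Fin 4)) = -1 := by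
  set a : OrthonormalBasis (Fin 4) ℝ (EuclideanSpace ℝ (Fin 4)) := EuclideanSpace.basisFun (Fin 4) ℝ
  have h := a.det_to_matrix_orthonormalBasis_real (a.map R)
  have hb : (⇑(a.map R) : Fin 4 → EuclideanSpace ℝ (Fin 4)) =
      ⇑(R.toLinearEquiv : EuclideanSpace ℝ (Fin 4) →ₗ[ℝ] EuclideanSpace ℝ (Fin 4)) ∘ ⇑a.toBasis := by
    funext k
    simp only [OrthonormalBasis.map_apply, Function.comp_apply, OrthonormalBasis.coe_toBasis,
      LinearEquiv.coe_coe, LinearIsometryEquiv.coe_toLinearEquiv]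
  rwa [hb, Module.Basis.det_comp, Module.Basis.det_self, mul_one] at h

/-- Determinants multiply under composition of linear isometries. [folklore] -/
theorem det_isometry4_trans (A B : EuclideanSpace ℝ (Fin 4) ≃ₗᵢ[ℝ] EuclideanSpace ℝ (Fin 4)) :
    LinearMap.det ((A.trans B).toLinearEquiv : EuclideanSpace ℝ (Fin 4) →ₗ[ℝ] EuclideanSpace ℝ (Fin 4)) =
      LinearMap.det (A.toLinearEquiv : EuclideanSpace ℝ (Fin 4) →ₗ[ℝ] EuclideanSpace ℝ (Fin 4)) *
        LinearMap.det (B.toLinearEquiv : EuclideanSpace ℝ (Fin 4) →ₗ[ℝ] EuclideanSpace ℝ (Fin 4)) := by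
  rw [LinearIsometryEquiv.toLinearEquiv_trans, LinearEquiv.coe_trans, LinearMap.det_comp, mul_comm]

/-- **`planeRot i t ∈ SO(4)`**: `det (planeRot i t) = det (planeRot i (t/2))² = (±1)² = 1`. [folklore] -/
theorem det_planeRot3 (i : Fin 3) (t : ℝ) :
    LinearMap.det ((planeRot (d := 3) i t).toLinearEquiv :
      EuclideanSpace ℝ (Fin 4) →ₗ[ℝ] EuclideanSpace ℝ (Fin 4)) = 1 := by
  have h : planeRot (d := 3) i t = (planeRot (d := 3) i (t / 2)).trans (planeRot (d := 3) i (t / 2)) := by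
    rw [← planeRot3_add, add_halves]
  rw [h, det_isometry4_trans]
  rcases det_isometry4_eq_one_or_eq_neg_one (planeRot (d := 3) i (t / 2)) with h1 | h1 <;> rw [h1] <;> norm_num

/-! ### The tilt -/

/-- `stub_smallRotation` — **a determinant-one isometry of `ℝ⁴` tilting the spatial axis `e_{i+1}` into
Euclidean time by a prescribed small amount**: for `σ ≠ 0`, `ρ > 0`, `g > 0` there is a linear isometry `R`
of `ℝ⁴` of determinant one and reals `c ∈ (0, 1]`, `s` of the sign of `σ`, with `(Rx)⁰ = c x⁰ + s x^{i+1}`,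
`(R⁻¹x)⁰ = c x⁰ − s x^{i+1}` and `(1 − c)ρ ≤ g`, `|s|ρ ≤ g`. Witness: the plane rotation
`planeRot (d := 3) i φ` with `φ = ±min 1 (g/ρ)` of the sign of `σ`, `c = cos φ`, `s = sin φ`
(`det = 1` by `det_planeRot3`). [folklore] -/
theorem stub_smallRotation :
    ∀ (i : Fin 3) (σ ρ g : ℝ), σ ≠ 0 → 0 < ρ → 0 < g →
      ∃ (R : EuclideanSpace ℝ (Fin 4) ≃ₗᵢ[ℝ] EuclideanSpace ℝ (Fin 4)) (c s : ℝ),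
        LinearMap.det (R.toLinearEquiv : EuclideanSpace ℝ (Fin 4) →ₗ[ℝ] EuclideanSpace ℝ (Fin 4)) = 1 ∧
        (∀ x : EuclideanSpace ℝ (Fin 4), R x 0 = c * x 0 + s * x i.succ) ∧
        (∀ x : EuclideanSpace ℝ (Fin 4), R.symm x 0 = c * x 0 - s * x i.succ) ∧
        0 < σ * s ∧ 0 < c ∧ c ≤ 1 ∧ (1 - c) * ρ ≤ g ∧ |s| * ρ ≤ g := by
  intro i σ ρ g hσ hρ hg
  -- the size `θ = min 1 (g/ρ) ∈ (0, 1]` of the angle, `θ ρ ≤ g`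
  obtain ⟨θ, hθ, hθ1, hθg⟩ : ∃ θ : ℝ, 0 < θ ∧ θ ≤ 1 ∧ θ * ρ ≤ g :=
    ⟨min 1 (g / ρ), lt_min one_pos (div_pos hg hρ), min_le_left _ _,
      (mul_le_mul_of_nonneg_right (min_le_right _ _) hρ.le).trans_eq (div_mul_cancel₀ g hρ.ne')⟩
  -- the angle `φ = ±θ` of the sign of `σ`
  obtain ⟨φ, hφθ, hσφ⟩ : ∃ φ : ℝ, |φ| = θ ∧ 0 < σ * Real.sin φ := by
    have hsin : 0 < Real.sin θ :=
      Real.sin_pos_of_pos_of_lt_pi hθ (hθ1.trans_lt (by linarith [Real.pi_gt_three]))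
    rcases lt_or_gt_of_ne hσ with h | h
    · exact ⟨-θ, by rw [abs_neg, abs_of_pos hθ],
        mul_pos_of_neg_of_neg h (by rwa [Real.sin_neg, neg_lt_zero])⟩
    · exact ⟨θ, abs_of_pos hθ, mul_pos h hsin⟩
  have hφ1 : |φ| ≤ 1 := hφθ.trans_le hθ1
  have hφg : |φ| * ρ ≤ g := by rw [hφθ]; exact hθg
  have hφlt : |φ| < Real.pi / 2 := hφ1.trans_lt (by linarith [Real.pi_gt_three])
  refine ⟨planeRot (d := 3) i φ, Real.cos φ, Real.sin φ, det_planeRot3 i φ, fun x => ?_, fun x => ?_, hσφ,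
    Real.cos_pos_of_mem_Ioo (abs_lt.mp hφlt), Real.cos_le_one φ, ?_, ?_⟩
  · -- `(R x)⁰ = cos φ x⁰ + sin φ x^{i+1}`
    rw [planeRot_apply, if_pos rfl]
  · -- `(R⁻¹ x)⁰ = cos φ x⁰ - sin φ x^{i+1}`
    rw [planeRot3_symm_apply, planeRot_apply, if_pos rfl, Real.cos_neg, Real.sin_neg]
    ring
  · -- `(1 - cos φ) ρ ≤ |φ| ρ ≤ g`
    have hc : 1 - Real.cos φ ≤ |φ| := by
      have h1 := Real.one_sub_sq_div_two_le_cos (x := φ)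
      have h2 : φ ^ 2 = |φ| ^ 2 := (sq_abs φ).symm
      nlinarith [abs_nonneg φ]
    exact (mul_le_mul_of_nonneg_right hc hρ.le).trans hφg
  · -- `|sin φ| ρ ≤ |φ| ρ ≤ g`
    exact (mul_le_mul_of_nonneg_right (Real.abs_sin_le_abs (x := φ)) hρ.le).trans hφg

end Summit.QuantumFields.YangMills.Theorems.ContinuumLegGivenGap
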